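import Mathlib
import Summits.ValiantsHypothesis.ValiantsHypothesis.Theorems.CharPSparseSOS.Negative.LoadBearing

/-!
# Crux `FeketeSOS.CharPSparseSOS` (stmt-ValiantsHypothesis-14989), line `Sketch` — stub
`twoCuspInequality_false_without_upperCusp`

Tightness of the two-cusp inequality: the LOWER cusp alone (vanishing constant coefficient and vanishing
top moments `Σ_{n<p} P̂(n) n^{p-1-d}`, `1 ≤ d < D`) does not bound the depth `D` by
`C₀ (s+1)^{A₀} (Σ #supp gᵢ)^θ` with `θ < 2`.  Witness: for a prime `p ≥ 5`, in `(ZMod p)[X]`, the digit tiling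
`p − 1 = ab + r` (`a = ⌊√(p−1)⌋`, `1 ≤ r ≤ a`, `b ≤ a + 2`) gives the EXACT four-square representation
`¼(P+Q)² − ¼(P−Q)² + ¼(M+T)² − ¼(M−T)² = X + X² + ⋯ + X^{p−1}` (`P = x + ⋯ + x^a`, `Q = Σ_{j<b} x^{aj}`,
`M = x^{ab+1}`, `T = 1 + ⋯ + x^{r−1}`) of degree `< p` and support-sum `≤ 12 √p`
(`CharPSparseSOS.Negative.sqg_sum`, `ones_digit_identity`).  The fold `Ones = X + ⋯ + X^{p−1}` has coefficient
function the indicator of `𝔽_p^×`, so `Ones.coeff 0 = 0` and every top moment is a power sum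
`Σ_{n<p} n^{e}` with `1 ≤ e = p − 1 − d ≤ p − 2`, which vanishes in `ZMod p`
(`FiniteField.sum_pow_lt_card_sub_one`).  Hence the hypotheses hold with `D = p − 1`, while the conclusion
would give `p − 1 ≤ C₀ 5^{A₀} (12 √p)^θ = O(p^{θ/2})`, false for large `p` since `θ < 2`.
-/

-- `Summit.ValiantsHypothesis.ValiantsHypothesis.…` is the tree's mandated single-conjunct layout (Sub = Summit).
set_option linter.dupNamespace false

namespace Summit.ValiantsHypothesis.ValiantsHypothesis.Theorems.CharPSparseSOSTwoCusp

open Polynomial Finset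
open Summit.ValiantsHypothesis.ValiantsHypothesis.Theorems.CharPSparseSOS.Negative

/-- **Vanishing power sums over `ZMod p`** indexed by `range p`: `Σ_{n<p} (n : ZMod p)^j = 0` for `j < p − 1`
(Mathlib's `FiniteField.sum_pow_lt_card_sub_one`, reindexed along `range p ≃ ZMod p`, `n ↦ (n : ZMod p)`,
inverse `ZMod.val`). [folklore] -/
theorem nuc_sum_range_pow_eq_zero (p : ℕ) [Fact p.Prime] (j : ℕ) (hj : j < p - 1) :
    ∑ n ∈ Finset.range p, ((n : ℕ) : ZMod p) ^ j = 0 := by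
  have h := FiniteField.sum_pow_lt_card_sub_one (ZMod p) j (by rwa [ZMod.card])
  rw [← h]
  exact Finset.sum_nbij' ((↑) : ℕ → ZMod p) ZMod.val (fun _ _ => Finset.mem_univ _)
    (fun x _ => Finset.mem_range.mpr (ZMod.val_lt x))
    (fun n hn => ZMod.val_cast_of_lt (Finset.mem_range.mp hn))
    (fun x _ => ZMod.natCast_zmod_val x) fun n _ => rfl

/-- The coefficient of `X^{k+1}` in `X + X² + ⋯ + X^N` is `1` for `k < N`. [folklore] -/
theorem nuc_ones_coeff_succ {K : Type} [Semiring K] (N k : ℕ) (hk : k < N) :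
    (∑ m ∈ range N, (X : K[X]) ^ (m + 1)).coeff (k + 1) = 1 := by
  simp [coeff_X_pow, hk]

/-- The constant coefficient of `X + X² + ⋯ + X^N` is `0`. [folklore] -/
theorem nuc_ones_coeff_zero {K : Type} [Semiring K] (N : ℕ) :
    (∑ m ∈ range N, (X : K[X]) ^ (m + 1)).coeff 0 = 0 := by
  simp [coeff_X_pow]

/-- `deg (X + X² + ⋯ + X^N) ≤ N`. [folklore] -/
theorem nuc_ones_natDegree_le {K : Type} [Semiring K] (N : ℕ) :
    (∑ m ∈ range N, (X : K[X]) ^ (m + 1)).natDegree ≤ N :=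
  natDegree_sum_le_of_forall_le _ _ fun m hm => (natDegree_X_pow_le _).trans (by
    have := mem_range.mp hm; omega)

/-- **The upper cusp is load-bearing in the two-cusp inequality (tightness).**  Deleting the hypothesis
`(X − 1)^D ∣ P` from the two-cusp inequality makes it false for every `θ < 2`: for a prime `p ≥ 5` the digit
tiling gives in `(ZMod p)[X]` four squares of degree `< p` and support-sum `≤ 12 √p` whose weighted sum is EXACTLY
`Ones = X + X² + ⋯ + X^{p−1}` (its own fold modulo `X^p − 1`); `Ones.coeff 0 = 0` and the top moments
`Σ_{n<p} Ones.coeff n · n^{p−1−d}` (`1 ≤ d < p − 1`) are the power sums `Σ_{n<p} n^{p−1−d} = 0`, so the lower-cusp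
hypotheses hold with `D = p − 1`, while `p − 1 ≤ C₀ 5^{A₀} (12 √p)^θ = (C₀ 5^{A₀} 12^θ) p^{θ/2}` fails as soon as
`p^{(2−θ)/2} ≥ 2 (C₀ 5^{A₀} 12^θ + 1)`. [folklore; digit tiling + power sums in characteristic `p`] -/
theorem twoCuspInequality_false_without_upperCusp :
    ¬ (∃ (C₀ θ : ℝ) (A₀ : ℕ), 0 < C₀ ∧ 0 ≤ θ ∧ θ < 2 ∧ ∀ (K : Type) [Field K] (p : ℕ) [Fact p.Prime] [CharP K p]
      (s : ℕ) (c : Fin s → K) (g : Fin s → K[X]) (P : K[X]) (D : ℕ), (∀ i, (g i).natDegree < p) →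
      P = (∑ i, C (c i) * g i ^ 2) %ₘ (X ^ p - 1) → P ≠ 0 → (1 ≤ D → P.coeff 0 = 0) →
      (∀ d : ℕ, 1 ≤ d → d < D → ∑ n ∈ Finset.range p, P.coeff n * (n : K) ^ (p - 1 - d) = 0) →
      (D : ℝ) ≤ C₀ * ((s : ℝ) + 1) ^ A₀ * ((∑ i, (g i).support.card : ℕ) : ℝ) ^ θ) := by
  rintro ⟨C₀, θ, A₀, hC₀, hθ0, hθ2, h⟩
  -- the constant `L = C₀ 5^{A₀} 12^θ` and a prime `p ≥ 5` with `p^{(2-θ)/2} ≥ 2 (L + 1)`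
  set L : ℝ := C₀ * 5 ^ A₀ * (12 : ℝ) ^ θ with hL
  have hL0 : 0 ≤ L := by
    rw [hL]; exact mul_nonneg (mul_nonneg hC₀.le (pow_nonneg (by norm_num) _)) (Real.rpow_nonneg (by norm_num) _)
  have hη : 0 < 2 - θ := by linarith
  obtain ⟨p, hp, hpprime⟩ := Nat.exists_infinite_primes (max (⌈(2 * (L + 1)) ^ (2 / (2 - θ))⌉₊) 5)
  haveI : Fact p.Prime := ⟨hpprime⟩
  have hp5 : 5 ≤ p := le_of_max_le_right hp
  have hpceil : ⌈(2 * (L + 1)) ^ (2 / (2 - θ))⌉₊ ≤ p := le_of_max_le_left hp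
  have h4 : (4 : ZMod p) ≠ 0 := four_ne_zero_zmod p hp5
  obtain ⟨N, rfl⟩ : ∃ N, p = N + 1 := ⟨p - 1, (Nat.succ_pred_eq_of_pos hpprime.pos).symm⟩
  -- digits of `N = p - 1`: `N = a * b + r`, `a = ⌊√N⌋`, `1 ≤ r ≤ a`, `b ≤ a + 2`
  set a := Nat.sqrt N with ha
  set b := (N - 1) / a with hb
  set r := N - a * b with hr
  have hN4 : 4 ≤ N := by omega
  have ha1 : 1 ≤ a := by rw [ha]; exact Nat.le_sqrt.mpr (by nlinarith)
  have hdm : N - 1 = a * b + (N - 1) % a := by rw [hb]; exact (Nat.div_add_mod (N - 1) a).symm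
  have hmod : (N - 1) % a < a := Nat.mod_lt _ ha1
  have hNabr : N = a * b + r := by omega
  have hra : r ≤ a := by omega
  have haa : a * a ≤ N := by rw [ha]; exact Nat.sqrt_le N
  have hNlt : N < (a + 1) * (a + 1) := by rw [ha]; exact Nat.lt_succ_sqrt N
  have hb_le : b ≤ a + 2 := by
    rw [hb]
    have : N - 1 ≤ a * (a + 2) := by
      have : N ≤ a * (a + 2) := by nlinarith
      omega
    calc (N - 1) / a ≤ (a * (a + 2)) / a := Nat.div_le_div_right this
      _ = a + 2 := Nat.mul_div_cancel_left _ ha1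
  have haN : a ≤ N := (Nat.le_mul_self a).trans haa
  -- the witness: four squares `sqg (x+⋯+x^a) (Σ_{j<b} x^{aj}) (x^{ab+1}) (1+⋯+x^{r-1})`, folding to `Ones`
  set T : (ZMod (N + 1))[X] := ∑ k ∈ range r, X ^ k with hT
  set M : (ZMod (N + 1))[X] := X ^ (a * b + 1) with hM
  set Ones : (ZMod (N + 1))[X] := ∑ m ∈ range N, X ^ (m + 1) with hO
  -- degrees `< p = N + 1`
  have hdeg : ∀ i, (sqg (lowDigits (ZMod (N + 1)) a) (highDigits (ZMod (N + 1)) a b) M T i).natDegree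
      < N + 1 := by
    have hle := sqg_natDegree (lowDigits (ZMod (N + 1)) a) (highDigits (ZMod (N + 1)) a b) M T N
      ((natDegree_lowDigits a).trans haN)
      ((natDegree_highDigits a b).trans (le_trans (Nat.mul_le_mul_left a (Nat.sub_le b 1)) (by omega)))
      (by rw [hM]; exact (natDegree_X_pow_le _).trans (by omega))
      (by
        rw [hT]
        exact natDegree_sum_le_of_forall_le _ _ fun k hk => (natDegree_X_pow_le _).trans (by
          have := mem_range.mp hk; omega))
    intro i; exact Nat.lt_succ_of_le (hle i)
  -- the identity (exact): the weighted four squares sum to `Ones`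
  have hid : (∑ i, C (sqc (ZMod (N + 1)) i) *
      sqg (lowDigits (ZMod (N + 1)) a) (highDigits (ZMod (N + 1)) a b) M T i ^ 2) = Ones := by
    rw [sqg_sum h4, hO, hM, hT, ← ones_digit_identity a b r, ← hNabr]
  -- `Ones` has degree `< p`, so it is its own fold modulo the monic `X^p - 1`
  have hmonic : ((X : (ZMod (N + 1))[X]) ^ (N + 1) - 1).Monic := by
    rw [← C_1]; exact monic_X_pow_sub_C _ (Nat.succ_ne_zero N)
  have hXdeg : ((X : (ZMod (N + 1))[X]) ^ (N + 1) - 1).natDegree = N + 1 := by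
    rw [← C_1, natDegree_X_pow_sub_C]
  have hOdeg : Ones.natDegree ≤ N := by rw [hO]; exact nuc_ones_natDegree_le N
  have hfold : Ones = (∑ i, C (sqc (ZMod (N + 1)) i) *
      sqg (lowDigits (ZMod (N + 1)) a) (highDigits (ZMod (N + 1)) a b) M T i ^ 2) %ₘ (X ^ (N + 1) - 1) := by
    rw [hid]
    exact ((modByMonic_eq_self_iff hmonic).mpr (degree_lt_degree (by rw [hXdeg]; omega))).symm
  -- `Ones ≠ 0` (its coefficient at `X` is `1`) and `Ones.coeff 0 = 0`
  have hne : Ones ≠ 0 := by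
    intro h0
    have h1 : Ones.coeff (0 + 1) = 1 := by rw [hO]; exact nuc_ones_coeff_succ N 0 (by omega)
    rw [h0, coeff_zero] at h1
    exact zero_ne_one h1
  have hc0 : 1 ≤ N → Ones.coeff 0 = 0 := fun _ => by rw [hO]; exact nuc_ones_coeff_zero N
  -- the top moments are the power sums `Σ_{n<p} n^e`, `1 ≤ e = p - 1 - d ≤ p - 2`, which vanish in `ZMod p`
  have hmom : ∀ d : ℕ, 1 ≤ d → d < N →
      ∑ n ∈ Finset.range (N + 1), Ones.coeff n * (n : ZMod (N + 1)) ^ (N + 1 - 1 - d) = 0 := by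
    intro d hd1 hdN
    have he : N + 1 - 1 - d ≠ 0 := by omega
    refine Eq.trans ?_ (nuc_sum_range_pow_eq_zero (N + 1) (N + 1 - 1 - d) (by omega))
    refine sum_congr rfl fun n hn => ?_
    rcases n with _ | k
    · rw [Nat.cast_zero, zero_pow he, mul_zero]
    · rw [hO, nuc_ones_coeff_succ N k (by have := mem_range.mp hn; omega), one_mul]
  have key := h (ZMod (N + 1)) (N + 1) 4 (sqc (ZMod (N + 1)))
    (sqg (lowDigits (ZMod (N + 1)) a) (highDigits (ZMod (N + 1)) a b) M T) Ones N hdeg hfold hne hc0 hmom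
  -- reals: `p ≥ 1`, `2 (L + 1) ≤ p^{(2-θ)/2}`, `p = p^{θ/2} p^{(2-θ)/2}`, `1 ≤ p^{θ/2}`
  have hp1 : (1 : ℝ) ≤ ((N + 1 : ℕ) : ℝ) := by exact_mod_cast Nat.succ_le_succ (Nat.zero_le N)
  have hp0 : (0 : ℝ) < ((N + 1 : ℕ) : ℝ) := lt_of_lt_of_le zero_lt_one hp1
  have hceil : (2 * (L + 1)) ^ (2 / (2 - θ)) ≤ ((N + 1 : ℕ) : ℝ) :=
    le_trans (Nat.le_ceil _) (by exact_mod_cast hpceil)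
  have hbig : 2 * (L + 1) ≤ ((N + 1 : ℕ) : ℝ) ^ ((2 - θ) / 2) := by
    have h1 : ((2 * (L + 1)) ^ (2 / (2 - θ))) ^ ((2 - θ) / 2) ≤ ((N + 1 : ℕ) : ℝ) ^ ((2 - θ) / 2) :=
      Real.rpow_le_rpow (Real.rpow_nonneg (by linarith) _) hceil (by linarith)
    have h2 : 2 / (2 - θ) * ((2 - θ) / 2) = 1 := by
      rw [div_mul_div_comm, mul_comm 2 (2 - θ), div_self (mul_ne_zero hη.ne' two_ne_zero)]
    rwa [← Real.rpow_mul (by linarith), h2, Real.rpow_one] at h1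
  have hsplit : ((N + 1 : ℕ) : ℝ) = ((N + 1 : ℕ) : ℝ) ^ (θ / 2) * ((N + 1 : ℕ) : ℝ) ^ ((2 - θ) / 2) := by
    rw [← Real.rpow_add hp0, show θ / 2 + (2 - θ) / 2 = 1 by ring, Real.rpow_one]
  have hone : 1 ≤ ((N + 1 : ℕ) : ℝ) ^ (θ / 2) := Real.one_le_rpow hp1 (by linarith)
  -- support-sum bookkeeping: `Σ #supp ≤ 2 (a + b + 1 + r) ≤ 12 √p`
  have hsupp := sqg_support (lowDigits (ZMod (N + 1)) a) (highDigits (ZMod (N + 1)) a b) M T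
  have hl : ((lowDigits (ZMod (N + 1)) a).support.card : ℝ) ≤ a := by exact_mod_cast card_support_lowDigits a
  have hh : ((highDigits (ZMod (N + 1)) a b).support.card : ℝ) ≤ b := mod_cast card_support_highDigits a b
  have hMc : (M.support.card : ℝ) ≤ 1 := by rw [hM]; exact_mod_cast card_support_X_pow_le _
  have hTc : (T.support.card : ℝ) ≤ r := by
    have : T.support.card ≤ r := by rw [hT]; exact (card_support_sum_X_pow_le (range r) id).trans (by simp)
    exact_mod_cast this
  have hb' : (b : ℝ) ≤ a + 2 := mod_cast hb_le
  have hr' : (r : ℝ) ≤ a := mod_cast hra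
  have hsqrt : (a : ℝ) ≤ Real.sqrt ((N + 1 : ℕ) : ℝ) := by
    rw [← Real.sqrt_sq (Nat.cast_nonneg a)]
    apply Real.sqrt_le_sqrt
    have : ((a * a : ℕ) : ℝ) ≤ ((N + 1 : ℕ) : ℝ) := by exact_mod_cast haa.trans (Nat.le_succ N)
    push_cast at this ⊢; nlinarith
  have hsqrt1 : (1 : ℝ) ≤ Real.sqrt ((N + 1 : ℕ) : ℝ) := by rw [← Real.sqrt_one]; exact Real.sqrt_le_sqrt hp1
  set S := ((∑ i, (sqg (lowDigits (ZMod (N + 1)) a) (highDigits (ZMod (N + 1)) a b) M T i).support.card : ℕ) : ℝ)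
    with hS
  set sq := Real.sqrt ((N + 1 : ℕ) : ℝ) with hsq
  have hS12 : S ≤ 12 * sq := by
    have hS' : S = ∑ i, ((sqg (lowDigits (ZMod (N + 1)) a) (highDigits (ZMod (N + 1)) a b) M T i).support.card : ℝ) := by
      rw [hS, Nat.cast_sum]
    rw [hS']; linarith
  have hS0 : 0 ≤ S := by rw [hS]; exact Nat.cast_nonneg _
  -- monotonicity: `S^θ ≤ (12 √p)^θ = 12^θ p^{θ/2}`
  have hrp1 : S ^ θ ≤ (12 * sq) ^ θ := Real.rpow_le_rpow hS0 hS12 hθ0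
  have hrp2 : (12 * sq) ^ θ = (12 : ℝ) ^ θ * ((N + 1 : ℕ) : ℝ) ^ (θ / 2) := by
    rw [Real.mul_rpow (by norm_num) (Real.sqrt_nonneg _), Real.sqrt_eq_rpow, ← Real.rpow_mul hp0.le,
      show (1 : ℝ) / 2 * θ = θ / 2 by ring]
  have h5 : ((4 : ℕ) : ℝ) + 1 = 5 := by norm_num
  rw [h5] at key
  set Pθ := ((N + 1 : ℕ) : ℝ) ^ (θ / 2) with hPθ
  set Pη := ((N + 1 : ℕ) : ℝ) ^ ((2 - θ) / 2) with hPη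
  have hNle : (N : ℝ) ≤ L * Pθ :=
    calc (N : ℝ) ≤ C₀ * 5 ^ A₀ * S ^ θ := key
      _ ≤ C₀ * 5 ^ A₀ * ((12 : ℝ) ^ θ * Pθ) :=
        mul_le_mul_of_nonneg_left (hrp1.trans hrp2.le) (mul_nonneg hC₀.le (pow_nonneg (by norm_num) _))
      _ = L * Pθ := by rw [hL]; ring
  -- contradiction: `N + 1 = p = Pθ Pη ≥ Pθ · 2 (L + 1) ≥ 2 L Pθ + 2`, but `N ≤ L Pθ`
  have hPθ0 : 0 ≤ Pθ := le_trans zero_le_one hone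
  have h1 : Pθ * (2 * (L + 1)) ≤ Pθ * Pη := mul_le_mul_of_nonneg_left hbig hPθ0
  have h2 : 2 * (L * Pθ) + 2 * Pθ ≤ Pθ * Pη :=
    calc 2 * (L * Pθ) + 2 * Pθ = Pθ * (2 * (L + 1)) := by ring
      _ ≤ Pθ * Pη := h1
  have hLP0 : 0 ≤ L * Pθ := mul_nonneg hL0 hPθ0
  have hNR : ((N + 1 : ℕ) : ℝ) = (N : ℝ) + 1 := by push_cast; ring
  rw [hNR] at hsplit
  linarith

end Summit.ValiantsHypothesis.ValiantsHypothesis.Theorems.CharPSparseSOSTwoCusp
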